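import Literature.Analysis.SingularIntegrals.HardyLittlewoodSobolev
import Literature.Analysis.FunctionSpaces.WeakLpQuantitative
import HarnessLib

/-!
# The Hardy–Littlewood–Sobolev inequality of WEAK type: Riesz potentials map `L^{p,∞}` to `L^{q,∞}`
(Stein 1970, Ch. V §1.2, Theorem 1 and its Comment §1.4; Grafakos, *Modern Fourier Analysis*,
Thm. 1.2.3 / Exercise 1.2.7 style Marcinkiewicz splitting)

Analysis/SingularIntegrals proof file (theorems only; no definition, no named fact). Over the
tree's Riesz potentials `rieszPotential μ α Φ x = ∫ Φ(y) ‖x − y‖^{α−n} dμ(y)`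
(`HardyLittlewoodSobolev.lean`, with the STRONG-type theorem of fractional integration
`lintegral_rieszPotential_rpow_le`: `∫ (I_αΦ)^q ≤ C (∫Φ^p)^{q/p}`, `q = np/(n − αp)`) and the tree's
weak-`L^p` functional `eWeakLpPow f p μ = sup_t t^p μ{‖f‖ > t}` / `MemWeakLp`
(`FunctionSpaces/WeakLp.lean`, with the quantitative truncations of `WeakLpQuantitative.lean`),
this file PROVES the weak-type companion:

* `meas_lt_rieszPotential_le_of_eWeakLpPow` — for `1 < p`, `0 < α`, `αp < n` there is a finite
  constant `C` such that for every a.e.-strongly measurable `f : E → F` and every `t > 0`,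
  `μ{x : t < I_α‖f‖(x)} ≤ C · W^{n/(n−αp)} · t^{−q}`, `W = sup_s s^p μ{‖f‖ > s}`,
  `q = np/(n − αp)` — i.e. `‖I_α|f|‖_{L^{q,∞}} ≤ C' ‖f‖_{L^{p,∞}}` in distribution-function form;
* `meas_lt_rieszPotential_le_of_lintegral_rpow` — the Chebyshev form of the strong inequality for
  one piece, and `rieszPotential_add` (additivity of `I_α` in the size).
The weak-`L^q` membership of `x ↦ (I_α‖f‖(x)).toReal`, the a.e. finiteness of the potential and the
`ℝ³`, `α = 1` instances (`p = 9/5 ↦ q = 9/2`, the endpoint Biot–Savart exponents of steady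
Navier–Stokes Liouville theory) are in the sibling `HardyLittlewoodSobolevWeakMembership.lean`.

Proof (Marcinkiewicz-type real interpolation from the strong inequality at two exponents, the
standard route to Lorentz-space bounds for positive kernels; Stein's Comment §1.4 to Ch. V obtains the
weak type `(1, n/(n−α))` the same way): for a height `λ > 0` split `f = f𝟙_{‖f‖>λ} + f𝟙_{‖f‖≤λ}`;
the first piece lies in `L^r`, `r < p`, with `∫‖·‖^r ≤ (p/(p−r)) λ^{r−p} W`, the second in `L^s`,
`p < s < n/α`, with `∫‖·‖^s ≤ (s/(s−p)) λ^{s−p} W` (tree: `MemWeakLp.lintegral_rpow_indicator_lt_norm_le`,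
`…_indicator_norm_le_le`); the strong inequality at `r` and at `s` and Chebyshev bound
`μ{t/2 < I_α(piece)}` by `t^{−q_r}(λ^{r−p}W)^{q_r/r}` and `t^{−q_s}(λ^{s−p}W)^{q_s/s}`; the choice
`λ = t^{n/(n−αp)} W^{−α/(n−αp)}` makes both equal to a constant times `W^{n/(n−αp)} t^{−q}`
(exponent bookkeeping: `exponent_identity`).

## Mathlib / tree search

`lean search 'weak.*HLS|Lorentz.*Sobolev|MemWeakLp.*riesz|rieszPotential.*Weak'`: nothing — the tree
has the strong HLS (`lintegral_rieszPotential_rpow_le(')`, `exists_hls_one_two_six`) and weak-`L^p`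
truncation bounds only; Mathlib (this pin) has no Riesz potentials. Consumed here: those two, Mathlib's
`meas_ge_le_lintegral_div` (Chebyshev), `ENNReal.ofReal_rpow_of_pos/_of_nonneg`.

## References

* E. M. Stein, *Singular integrals and differentiability properties of functions*, Princeton Math.
  Series 30 (1970): Ch. V §1.2 Theorem 1, §1.4 (Comment: weak-type estimate by splitting).
  [Stein1971]
* L. Grafakos, *Classical Fourier Analysis*, 3rd ed., Thm. 1.3.2 (Marcinkiewicz) and §1.4.
  [Grafakos2014]
-/

noncomputable section

open MeasureTheory Metric Set Filter Topology Real
open scoped ENNReal NNReal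

namespace Literature.Analysis.SingularIntegrals

open Literature.Analysis.FunctionSpaces

universe u

variable {E : Type u} [NormedAddCommGroup E] [NormedSpace ℝ E] [FiniteDimensional ℝ E]
  [MeasurableSpace E] [BorelSpace E] (μ : Measure E) [μ.IsAddHaarMeasure]
variable {F : Type*} [NormedAddCommGroup F]

/-! ### Exponent bookkeeping -/

/-- The exponent identities behind the choice `λ = t^{a} W^{b}`, `a = n/(n−αp)`, `b = −α/(n−αp)`:
for any third exponent `r` with `n ≠ αr`, writing `a_r = n/(n−αr)`, `q_r = nr/(n−αr)`,
`q = np/(n−αp)`: `a(r−p)a_r − q_r = −q` and `(1 + b(r−p))a_r = q/p`. [folklore] -/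
private theorem exponent_identity {n α p r : ℝ} (hnp : n - α * p ≠ 0)
    (hnr : n - α * r ≠ 0) :
    n / (n - α * p) * (r - p) * (n / (n - α * r)) - n * r / (n - α * r) = -(n * p / (n - α * p)) ∧
      (1 + -α / (n - α * p) * (r - p)) * (n / (n - α * r)) = n / (n - α * p) := by
  constructor
  · field_simp
    ring
  · field_simp
    ring

/-- The scaling identity: with `λ = t^{n/(n−αp)} W^{−α/(n−αp)}`,
`(c λ^{r−p} W)^{n/(n−αr)} / (t/2)^{nr/(n−αr)} = c^{n/(n−αr)} 2^{nr/(n−αr)} · (W^{n/(n−αp)} t^{−np/(n−αp)})`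
(`t, W, c > 0`). [folklore] -/
private theorem scaling_identity {n α p r t W c : ℝ} (hnp : n - α * p ≠ 0)
    (hnr : n - α * r ≠ 0) (ht : 0 < t) (hW : 0 < W) (hc : 0 < c) :
    (c * (t ^ (n / (n - α * p)) * W ^ (-α / (n - α * p))) ^ (r - p) * W) ^ (n / (n - α * r)) /
        (t / 2) ^ (n * r / (n - α * r)) =
      c ^ (n / (n - α * r)) * 2 ^ (n * r / (n - α * r)) *
        (W ^ (n / (n - α * p)) * t ^ (-(n * p / (n - α * p)))) := by
  obtain ⟨e1, e2⟩ := exponent_identity (n := n) (α := α) (p := p) hnp hnr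
  set a : ℝ := n / (n - α * p)
  set b : ℝ := -α / (n - α * p)
  set ar : ℝ := n / (n - α * r)
  set qr : ℝ := n * r / (n - α * r)
  set q : ℝ := n * p / (n - α * p)
  have hlam : t ^ a * W ^ b = exp (log t * a + log W * b) := by
    rw [rpow_def_of_pos ht, rpow_def_of_pos hW, ← exp_add]
  have hlam_pos : 0 < t ^ a * W ^ b := by rw [hlam]; exact exp_pos _
  have h1 : (t ^ a * W ^ b) ^ (r - p) = exp ((log t * a + log W * b) * (r - p)) := by
    rw [hlam, rpow_def_of_pos (exp_pos _), log_exp]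
  have h2 : c * (t ^ a * W ^ b) ^ (r - p) * W =
      exp (log c + (log t * a + log W * b) * (r - p) + log W) := by
    rw [h1, exp_add, exp_add, exp_log hc, exp_log hW]
  have h3 : (c * (t ^ a * W ^ b) ^ (r - p) * W) ^ ar =
      exp ((log c + (log t * a + log W * b) * (r - p) + log W) * ar) := by
    rw [h2, rpow_def_of_pos (exp_pos _), log_exp]
  have h4 : (t / 2) ^ qr = exp ((log t - log 2) * qr) := by
    rw [rpow_def_of_pos (by positivity), log_div ht.ne' two_ne_zero]
  have h5 : c ^ ar * 2 ^ qr * (W ^ a * t ^ (-q)) =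
      exp (log c * ar + log 2 * qr + (log W * a + log t * (-q))) := by
    rw [rpow_def_of_pos hc, rpow_def_of_pos two_pos, rpow_def_of_pos hW, rpow_def_of_pos ht,
      ← exp_add, ← exp_add, ← exp_add]
  rw [h3, h4, ← exp_sub, h5]
  congr 1
  linear_combination (log t) * e1 + (log W) * e2

/-! ### One piece: Chebyshev + the strong inequality -/

omit [μ.IsAddHaarMeasure] in
/-- The Riesz potential is additive in the size: `I_α(Φ + Ψ) = I_αΦ + I_αΨ` for measurable `Φ`.
[cite: Stein1971, Ch. V §1.1 (4)] -/
theorem rieszPotential_add {α : ℝ} {Φ Ψ : E → ℝ≥0∞} (hΦ : Measurable Φ) (x : E) :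
    rieszPotential μ α (Φ + Ψ) x = rieszPotential μ α Φ x + rieszPotential μ α Ψ x := by
  simp only [rieszPotential_def, Pi.add_apply, add_mul]
  have hK : Measurable fun y : E => ENNReal.ofReal (‖x - y‖ ^ (α - (Module.finrank ℝ E : ℝ))) :=
    ENNReal.measurable_ofReal.comp ((measurable_const.sub measurable_id).norm.pow_const _)
  exact lintegral_add_left (hΦ.mul hK) _

/-- **Chebyshev + strong HLS for one piece**: for `1 < r`, `αr < n`, with the constant `C` of
`lintegral_rieszPotential_rpow_le` at `r`: for measurable `Ψ` and `τ > 0`,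
`μ{τ < I_αΨ} ≤ C (∫Ψ^r)^{n/(n−αr)} / τ^{nr/(n−αr)}`. [cite: Stein1971, Ch. V §1.2 Theorem 1 (b)] -/
theorem meas_lt_rieszPotential_le_of_lintegral_rpow {α r : ℝ} (hr : 1 < r) (hα : 0 < α)
    (hαr : α * r < (Module.finrank ℝ E : ℝ)) {C : ℝ≥0∞}
    (hC : ∀ Φ : E → ℝ≥0∞, AEMeasurable Φ μ →
      ∫⁻ x, rieszPotential μ α Φ x ^
          ((Module.finrank ℝ E : ℝ) * r / ((Module.finrank ℝ E : ℝ) - α * r)) ∂μ ≤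
        C * (∫⁻ y, Φ y ^ r ∂μ) ^ ((Module.finrank ℝ E : ℝ) / ((Module.finrank ℝ E : ℝ) - α * r)))
    {Ψ : E → ℝ≥0∞} (hΨ : Measurable Ψ) {τ : ℝ} (hτ : 0 < τ) :
    μ {x | ENNReal.ofReal τ < rieszPotential μ α Ψ x} ≤
      C * (∫⁻ y, Ψ y ^ r ∂μ) ^ ((Module.finrank ℝ E : ℝ) / ((Module.finrank ℝ E : ℝ) - α * r)) /
        ENNReal.ofReal (τ ^ ((Module.finrank ℝ E : ℝ) * r / ((Module.finrank ℝ E : ℝ) - α * r))) := by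
  set n : ℝ := (Module.finrank ℝ E : ℝ) with hn
  set qr : ℝ := n * r / (n - α * r) with hqr
  have hr0 : 0 < r := by linarith
  have hnr : 0 < n - α * r := by linarith
  have hn0 : 0 < n := lt_trans (mul_pos hα hr0) hαr
  have hqr0 : 0 < qr := div_pos (mul_pos hn0 hr0) hnr
  have hI : Measurable (rieszPotential μ α Ψ) := measurable_rieszPotential μ α hΨ
  -- `{τ < IΨ} ⊆ {τ^{q_r} ≤ (IΨ)^{q_r}}`
  have hsub : {x | ENNReal.ofReal τ < rieszPotential μ α Ψ x} ⊆
      {x | ENNReal.ofReal τ ^ qr ≤ rieszPotential μ α Ψ x ^ qr} := fun x hx =>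
    ENNReal.rpow_le_rpow (le_of_lt hx) hqr0.le
  have hε0 : ENNReal.ofReal τ ^ qr ≠ 0 := by
    rw [ENNReal.ofReal_rpow_of_pos hτ]
    exact (ENNReal.ofReal_pos.2 (Real.rpow_pos_of_pos hτ _)).ne'
  have hεt : ENNReal.ofReal τ ^ qr ≠ ∞ := ENNReal.rpow_ne_top_of_nonneg hqr0.le ENNReal.ofReal_ne_top
  calc μ {x | ENNReal.ofReal τ < rieszPotential μ α Ψ x}
      ≤ μ {x | ENNReal.ofReal τ ^ qr ≤ rieszPotential μ α Ψ x ^ qr} := measure_mono hsub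
    _ ≤ (∫⁻ x, rieszPotential μ α Ψ x ^ qr ∂μ) / ENNReal.ofReal τ ^ qr :=
        meas_ge_le_lintegral_div (hI.pow_const qr).aemeasurable hε0 hεt
    _ ≤ C * (∫⁻ y, Ψ y ^ r ∂μ) ^ (n / (n - α * r)) / ENNReal.ofReal τ ^ qr :=
        ENNReal.div_le_div_right (hC Ψ hΨ.aemeasurable) _
    _ = C * (∫⁻ y, Ψ y ^ r ∂μ) ^ (n / (n - α * r)) / ENNReal.ofReal (τ ^ qr) := by
        rw [ENNReal.ofReal_rpow_of_pos hτ]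

/-! ### The weak-type inequality -/

/-- The enorm of a truncation is the truncation of the enorm:
`‖f‖ₑ = ‖f𝟙_{λ<‖f‖}‖ₑ + ‖f𝟙_{‖f‖≤λ}‖ₑ` pointwise. [folklore] -/
private theorem enorm_eq_add_pieces {X : Type*} (f : X → F) (lam : ℝ) (y : X) :
    (‖f y‖ₑ : ℝ≥0∞) = ‖{x | lam < ‖f x‖}.indicator f y‖ₑ + ‖{x | ‖f x‖ ≤ lam}.indicator f y‖ₑ := by
  by_cases h : lam < ‖f y‖
  · have h1 : y ∈ {x | lam < ‖f x‖} := h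
    have h2 : y ∉ {x | ‖f x‖ ≤ lam} := fun h' => absurd h (not_lt.2 h')
    rw [indicator_of_mem h1, indicator_of_notMem h2, enorm_zero, add_zero]
  · have h1 : y ∉ {x | lam < ‖f x‖} := h
    have h2 : y ∈ {x | ‖f x‖ ≤ lam} := not_lt.1 h
    rw [indicator_of_notMem h1, indicator_of_mem h2, enorm_zero, zero_add]

/-- If `sup_t t^p μ{‖f‖ > t} = 0` then `‖f‖ₑ = 0` a.e. [folklore] -/
private theorem enorm_ae_eq_zero_of_eWeakLpPow_eq_zero {X : Type*} [MeasurableSpace X]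
    {ν : Measure X} {f : X → F} {p : ℝ≥0∞}
    (hW : eWeakLpPow f p ν = 0) : (fun y => (‖f y‖ₑ : ℝ≥0∞)) =ᵐ[ν] 0 := by
  have hlev : ∀ k : ℕ, ν {y | 1 / ((k : ℝ) + 1) < ‖f y‖} = 0 := by
    intro k
    have h := meas_lt_norm_le_eWeakLpPow_mul_ofReal_rpow_neg f p ν
      (t := 1 / ((k : ℝ) + 1)) (by positivity)
    rw [hW, zero_mul] at h
    exact nonpos_iff_eq_zero.1 h
  have hU : {y | (‖f y‖ₑ : ℝ≥0∞) ≠ 0} ⊆ ⋃ k : ℕ, {y | 1 / ((k : ℝ) + 1) < ‖f y‖} := by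
    intro y hy
    rw [mem_setOf_eq] at hy
    have hpos : 0 < ‖f y‖ := by
      rw [norm_pos_iff]
      intro h0; exact hy (by rw [h0, enorm_zero])
    obtain ⟨k, hk⟩ := exists_nat_one_div_lt hpos
    exact mem_iUnion.2 ⟨k, hk⟩
  rw [Filter.EventuallyEq, ae_iff]
  refine measure_mono_null (fun y hy => hU hy) ?_
  exact (measure_iUnion_null_iff).2 hlev

/-- **Hardy–Littlewood–Sobolev, weak type (distribution-function form).** Let `1 < p`, `0 < α`,
`αp < n = dim E`, `q = np/(n − αp)`. There is a finite constant `C` such that for every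
a.e.-strongly measurable `f : E → F` and every `t > 0`,
`μ{x | t < I_α‖f‖(x)} ≤ C · (sup_s s^p μ{‖f‖ > s})^{n/(n−αp)} · t^{−q}`, i.e.
`‖I_α|f|‖_{L^{q,∞}} ≲ ‖f‖_{L^{p,∞}}` — the Riesz potential of order `α` is of weak type
`(L^{p,∞}, L^{q,∞})`. (Stein, Ch. V §1.2 Thm 1 gives the strong type for `L^p` data; the Lorentz /
Marcinkiewicz extension to weak-`L^p` data follows from it by the height splitting of §1.4.)
[cite: Stein1971, Ch. V §1.2 Theorem 1 and §1.4 (Comment)] -/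
theorem meas_lt_rieszPotential_le_of_eWeakLpPow {α : ℝ} {p : ℝ≥0∞} (hp : 1 < p.toReal) (hα : 0 < α)
    (hαp : α * p.toReal < (Module.finrank ℝ E : ℝ)) :
    ∃ C : ℝ≥0∞, C < ∞ ∧ ∀ (f : E → F), AEStronglyMeasurable f μ → ∀ t : ℝ, 0 < t →
      μ {x | ENNReal.ofReal t < rieszPotential μ α (fun y => ‖f y‖ₑ) x} ≤
        C * eWeakLpPow f p μ ^ ((Module.finrank ℝ E : ℝ) / ((Module.finrank ℝ E : ℝ) - α * p.toReal)) *
          ENNReal.ofReal (t ^ (-((Module.finrank ℝ E : ℝ) * p.toReal /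
            ((Module.finrank ℝ E : ℝ) - α * p.toReal)))) := by
  set n : ℝ := (Module.finrank ℝ E : ℝ) with hn
  set P : ℝ := p.toReal with hP
  have hP0 : 0 < P := by linarith
  have hnP : 0 < n - α * P := by linarith
  have hn0 : 0 < n := lt_trans (mul_pos hα hP0) hαp
  -- the two auxiliary exponents `r < P < s`
  set r : ℝ := (1 + P) / 2 with hr
  set s : ℝ := (P + n / α) / 2 with hs
  have hr1 : 1 < r := by rw [hr]; linarith
  have hrP : r < P := by rw [hr]; linarith
  have hnα : P < n / α := by rw [lt_div_iff₀ hα]; linarith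
  have hPs : P < s := by rw [hs]; linarith
  have hs1 : 1 < s := by linarith
  have hαr : α * r < n := by nlinarith
  have hαs : α * s < n := by
    have : s < n / α := by rw [hs]; linarith
    have := (lt_div_iff₀ hα).1 this
    linarith
  have hnr : 0 < n - α * r := by linarith
  have hns : 0 < n - α * s := by linarith
  obtain ⟨Cr, hCr, Hr⟩ := lintegral_rieszPotential_rpow_le μ hr1 hα hαr
  obtain ⟨Cs, hCs, Hs⟩ := lintegral_rieszPotential_rpow_le μ hs1 hα hαs
  -- constants
  set a : ℝ := n / (n - α * P) with ha
  set b : ℝ := -α / (n - α * P) with hb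
  set q : ℝ := n * P / (n - α * P) with hq
  set ar : ℝ := n / (n - α * r) with har
  set qr : ℝ := n * r / (n - α * r) with hqr
  set as : ℝ := n / (n - α * s) with has
  set qs : ℝ := n * s / (n - α * s) with hqs
  set cb : ℝ := P / (P - r) with hcb
  set cs : ℝ := s / (s - P) with hcs
  have hcb0 : 0 < cb := div_pos hP0 (by linarith)
  have hcs0 : 0 < cs := div_pos (by linarith) (by linarith)
  have ha0 : 0 < a := div_pos hn0 hnP
  have hq0 : 0 < q := div_pos (mul_pos hn0 hP0) hnP
  have har0 : 0 < ar := div_pos hn0 hnr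
  have has0 : 0 < as := div_pos hn0 hns
  set Kb : ℝ≥0∞ := Cr * ENNReal.ofReal (cb ^ ar * 2 ^ qr) with hKb
  set Ks : ℝ≥0∞ := Cs * ENNReal.ofReal (cs ^ as * 2 ^ qs) with hKs
  refine ⟨1 + Kb + Ks, ?_, fun f hf t ht => ?_⟩
  · refine ENNReal.add_lt_top.2 ⟨ENNReal.add_lt_top.2 ⟨ENNReal.one_lt_top, ?_⟩, ?_⟩
    · exact ENNReal.mul_lt_top hCr ENNReal.ofReal_lt_top
    · exact ENNReal.mul_lt_top hCs ENNReal.ofReal_lt_top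
  -- pass to a strongly measurable representative
  set g : E → F := hf.mk f with hg
  have hgm : StronglyMeasurable g := hf.stronglyMeasurable_mk
  have hfg : f =ᵐ[μ] g := hf.ae_eq_mk
  have hΦ : (fun y => (‖f y‖ₑ : ℝ≥0∞)) =ᵐ[μ] fun y => (‖g y‖ₑ : ℝ≥0∞) :=
    hfg.mono fun y hy => by simp [hy]
  have hIfg : rieszPotential μ α (fun y => ‖f y‖ₑ) = rieszPotential μ α (fun y => ‖g y‖ₑ) :=
    rieszPotential_congr_ae μ α hΦ
  have hWfg : eWeakLpPow f p μ = eWeakLpPow g p μ := eWeakLpPow_congr_ae hfg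
  rw [hIfg, hWfg]
  set W : ℝ≥0∞ := eWeakLpPow g p μ with hW
  -- the degenerate cases `W = ⊤`, `W = 0`
  rcases eq_or_ne W ⊤ with hWtop | hWtop
  · rw [hWtop, ENNReal.top_rpow_of_pos ha0, ENNReal.mul_top (by positivity), ENNReal.top_mul]
    · exact le_top
    · exact (ENNReal.ofReal_pos.2 (Real.rpow_pos_of_pos ht _)).ne'
  rcases eq_or_ne W 0 with hW0 | hW0
  · have hz : (fun y => (‖g y‖ₑ : ℝ≥0∞)) =ᵐ[μ] 0 :=
      enorm_ae_eq_zero_of_eWeakLpPow_eq_zero hW0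
    have hI0 : ∀ x, rieszPotential μ α (fun y => ‖g y‖ₑ) x = 0 := fun x =>
      rieszPotential_eq_zero_of_ae_eq_zero μ α hz x
    have : {x | ENNReal.ofReal t < rieszPotential μ α (fun y => ‖g y‖ₑ) x} = ∅ := by
      ext x; simp [hI0 x]
    rw [this, measure_empty]
    exact bot_le
  -- main case `0 < W < ⊤`
  set Wr : ℝ := W.toReal with hWr
  have hWr0 : 0 < Wr := ENNReal.toReal_pos hW0 hWtop
  have hWeq : W = ENNReal.ofReal Wr := (ENNReal.ofReal_toReal hWtop).symm
  set lam : ℝ := t ^ a * Wr ^ b with hlam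
  have hlam0 : 0 < lam := mul_pos (Real.rpow_pos_of_pos ht _) (Real.rpow_pos_of_pos hWr0 _)
  -- the two pieces
  set gb : E → F := {x | lam < ‖g x‖}.indicator g with hgb
  set gs : E → F := {x | ‖g x‖ ≤ lam}.indicator g with hgs
  have hA : MeasurableSet {x | lam < ‖g x‖} := measurableSet_lt measurable_const hgm.norm.measurable
  have hB : MeasurableSet {x | ‖g x‖ ≤ lam} := measurableSet_le hgm.norm.measurable measurable_const
  have hgbm : Measurable fun y => (‖gb y‖ₑ : ℝ≥0∞) := (hgm.indicator hA).enorm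
  have hgsm : Measurable fun y => (‖gs y‖ₑ : ℝ≥0∞) := (hgm.indicator hB).enorm
  have hsplit : (fun y => (‖g y‖ₑ : ℝ≥0∞)) = (fun y => (‖gb y‖ₑ : ℝ≥0∞)) + fun y => (‖gs y‖ₑ : ℝ≥0∞) := by
    funext y; exact enorm_eq_add_pieces g lam y
  have hIadd : ∀ x, rieszPotential μ α (fun y => ‖g y‖ₑ) x =
      rieszPotential μ α (fun y => ‖gb y‖ₑ) x + rieszPotential μ α (fun y => ‖gs y‖ₑ) x := by
    intro x; rw [hsplit]; exact rieszPotential_add μ hgbm x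
  -- truncation bounds (tree, WeakLpQuantitative)
  have hbig : ∫⁻ y, (‖gb y‖ₑ : ℝ≥0∞) ^ r ∂μ ≤ ENNReal.ofReal (cb * lam ^ (r - P)) * W :=
    MemWeakLp.lintegral_rpow_indicator_lt_norm_le hgm.aestronglyMeasurable hA (by linarith) hrP hlam0
  have hsmall : ∫⁻ y, (‖gs y‖ₑ : ℝ≥0∞) ^ s ∂μ ≤ ENNReal.ofReal (cs * lam ^ (s - P)) * W :=
    MemWeakLp.lintegral_rpow_indicator_norm_le_le hgm.aestronglyMeasurable hB hPs hlam0
  -- the level `τ = t/2` and the union bound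
  have hτ : 0 < t / 2 := by linarith
  have hsub : {x | ENNReal.ofReal t < rieszPotential μ α (fun y => ‖g y‖ₑ) x} ⊆
      {x | ENNReal.ofReal (t / 2) < rieszPotential μ α (fun y => ‖gb y‖ₑ) x} ∪
        {x | ENNReal.ofReal (t / 2) < rieszPotential μ α (fun y => ‖gs y‖ₑ) x} := by
    intro x hx
    rw [mem_setOf_eq, hIadd x] at hx
    by_contra hc
    rw [mem_union, mem_setOf_eq, mem_setOf_eq, not_or, not_lt, not_lt] at hc
    have h2 : ENNReal.ofReal t = ENNReal.ofReal (t / 2) + ENNReal.ofReal (t / 2) := by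
      rw [← ENNReal.ofReal_add hτ.le hτ.le]; ring_nf
    rw [h2] at hx
    exact absurd (add_le_add hc.1 hc.2) (not_le.2 hx)
  have hTb := meas_lt_rieszPotential_le_of_lintegral_rpow μ hr1 hα hαr Hr hgbm hτ
  have hTs := meas_lt_rieszPotential_le_of_lintegral_rpow μ hs1 hα hαs Hs hgsm hτ
  -- evaluate the big piece
  have hXb : 0 ≤ cb * lam ^ (r - P) * Wr := by positivity
  have hXs : 0 ≤ cs * lam ^ (s - P) * Wr := by positivity
  have hτqr : 0 < (t / 2) ^ qr := Real.rpow_pos_of_pos hτ _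
  have hτqs : 0 < (t / 2) ^ qs := Real.rpow_pos_of_pos hτ _
  have idb := scaling_identity (n := n) (α := α) (p := P) (r := r) (c := cb) hnP.ne' hnr.ne' ht hWr0 hcb0
  have ids := scaling_identity (n := n) (α := α) (p := P) (r := s) (c := cs) hnP.ne' hns.ne' ht hWr0 hcs0
  have hTb' : μ {x | ENNReal.ofReal (t / 2) < rieszPotential μ α (fun y => ‖gb y‖ₑ) x} ≤
      Kb * W ^ a * ENNReal.ofReal (t ^ (-q)) := by
    refine hTb.trans ?_
    calc Cr * (∫⁻ y, (‖gb y‖ₑ : ℝ≥0∞) ^ r ∂μ) ^ ar / ENNReal.ofReal ((t / 2) ^ qr)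
        ≤ Cr * (ENNReal.ofReal (cb * lam ^ (r - P)) * W) ^ ar / ENNReal.ofReal ((t / 2) ^ qr) := by
          gcongr
      _ = Cr * (ENNReal.ofReal ((cb * lam ^ (r - P) * Wr) ^ ar) / ENNReal.ofReal ((t / 2) ^ qr)) := by
          rw [hWeq, ← ENNReal.ofReal_mul (by positivity), ENNReal.ofReal_rpow_of_nonneg hXb har0.le,
            mul_div_assoc]
      _ = Cr * ENNReal.ofReal ((cb * lam ^ (r - P) * Wr) ^ ar / (t / 2) ^ qr) := by
          rw [ENNReal.ofReal_div_of_pos hτqr]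
      _ = Cr * ENNReal.ofReal (cb ^ ar * 2 ^ qr * (Wr ^ a * t ^ (-q))) := by rw [hlam, idb]
      _ = Kb * W ^ a * ENNReal.ofReal (t ^ (-q)) := by
          rw [hKb, hWeq, ENNReal.ofReal_rpow_of_pos hWr0,
            ENNReal.ofReal_mul (by positivity : (0 : ℝ) ≤ cb ^ ar * 2 ^ qr),
            ENNReal.ofReal_mul (le_of_lt (Real.rpow_pos_of_pos hWr0 a))]
          ring
  have hTs' : μ {x | ENNReal.ofReal (t / 2) < rieszPotential μ α (fun y => ‖gs y‖ₑ) x} ≤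
      Ks * W ^ a * ENNReal.ofReal (t ^ (-q)) := by
    refine hTs.trans ?_
    calc Cs * (∫⁻ y, (‖gs y‖ₑ : ℝ≥0∞) ^ s ∂μ) ^ as / ENNReal.ofReal ((t / 2) ^ qs)
        ≤ Cs * (ENNReal.ofReal (cs * lam ^ (s - P)) * W) ^ as / ENNReal.ofReal ((t / 2) ^ qs) := by
          gcongr
      _ = Cs * (ENNReal.ofReal ((cs * lam ^ (s - P) * Wr) ^ as) / ENNReal.ofReal ((t / 2) ^ qs)) := by
          rw [hWeq, ← ENNReal.ofReal_mul (by positivity), ENNReal.ofReal_rpow_of_nonneg hXs has0.le,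
            mul_div_assoc]
      _ = Cs * ENNReal.ofReal ((cs * lam ^ (s - P) * Wr) ^ as / (t / 2) ^ qs) := by
          rw [ENNReal.ofReal_div_of_pos hτqs]
      _ = Cs * ENNReal.ofReal (cs ^ as * 2 ^ qs * (Wr ^ a * t ^ (-q))) := by rw [hlam, ids]
      _ = Ks * W ^ a * ENNReal.ofReal (t ^ (-q)) := by
          rw [hKs, hWeq, ENNReal.ofReal_rpow_of_pos hWr0,
            ENNReal.ofReal_mul (by positivity : (0 : ℝ) ≤ cs ^ as * 2 ^ qs),
            ENNReal.ofReal_mul (le_of_lt (Real.rpow_pos_of_pos hWr0 a))]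
          ring
  calc μ {x | ENNReal.ofReal t < rieszPotential μ α (fun y => ‖g y‖ₑ) x}
      ≤ μ ({x | ENNReal.ofReal (t / 2) < rieszPotential μ α (fun y => ‖gb y‖ₑ) x} ∪
          {x | ENNReal.ofReal (t / 2) < rieszPotential μ α (fun y => ‖gs y‖ₑ) x}) := measure_mono hsub
    _ ≤ μ {x | ENNReal.ofReal (t / 2) < rieszPotential μ α (fun y => ‖gb y‖ₑ) x} +
          μ {x | ENNReal.ofReal (t / 2) < rieszPotential μ α (fun y => ‖gs y‖ₑ) x} :=
        measure_union_le _ _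
    _ ≤ Kb * W ^ a * ENNReal.ofReal (t ^ (-q)) + Ks * W ^ a * ENNReal.ofReal (t ^ (-q)) :=
        add_le_add hTb' hTs'
    _ = (Kb + Ks) * W ^ a * ENNReal.ofReal (t ^ (-q)) := by ring
    _ ≤ (1 + Kb + Ks) * W ^ a * ENNReal.ofReal (t ^ (-q)) := by
        gcongr
        exact le_add_self

end Literature.Analysis.SingularIntegrals

end

-- WHAT THIS IS NOT: not a claim about NS regularity or blow-up; not a claim about any author beyond the typed locator.
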